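import Mathlib.Analysis.SpecialFunctions.Pow.Real
import Literature.Computability.Complexity.PEASigmaTwoEntropy
import Literature.Computability.Complexity.PEASigmaTwoSetSize
import Literature.Computability.Complexity.SipserGacsLautemann
import HarnessLib

/-!
# Entropy approximation in `Σ₂ᵖ`, V: the hashing criterion

Fifth file of the proof of `PEA d ∈ promiseLift (SigmaP 2)`.  With the parameters of
`PEASigmaTwoProgram.lean` (`T = 128 n'²` samples, `N = T n'`, `r = T(n'-k) - T/2` hash rows,
`M = N + (rN + r)`, `t = M + 5`, level `κ = t(M-1)`) and `H = H(Q(U))` the output entropy of the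
renamed map on `n'` used variables:

* **`four_mul_card_npSet_le`** — if `k + 1 ≤ H` (YES) then `4 |S| ≤ 2^M`: all but an eighth of the
  sample tuples have product fibre `≤ 2^{T(n'-k-1) + T/4} = 2^{r - T/4}` (`card_far_logfib_le`), and an
  affine hash hits a set of that size with probability `≤ 2^{-T/4}` (`card_hitSet_le`);
* **`three_mul_two_pow_le_four_mul_card_npSet`** — if `H ≤ k < n'` (NO) then `3 · 2^M ≤ 4 |S|`:
  all but an eighth of the tuples have fibre `≥ 2^{r + T/4}`, which a hash misses with probability
  `≤ 2^{-T/4}` (`card_missSet_mul_le`);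
* **`hashable_of_entropy_ge` / `not_hashable_of_entropy_le`** — hence, by Sipser's Coding Lemma in the
  tree's product form (`SipserGacs.hashable_tuplePow_of_small`,
  `SipserGacs.not_hashable_tuplePow_of_large`), `S^t` is hashable at level `κ` on YES instances of
  `PEA d` and not hashable on NO instances with `k < n'` (on NO instances with `k ≥ n'` the program
  rejects by its guard).

## References

* M. Sipser, *A complexity theoretic approach to randomness*, STOC 1983, §III, §V.
* O. Goldreich, A. Sahai, S. Vadhan, CRYPTO 1999 (Entropy Approximation is in `NISZK ⊆ AM ∩ coAM`).
* Z. Dvir, D. Gutfreund, G. N. Rothblum, S. Vadhan, ECCC TR10-160 (2010), §3.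
-/

namespace Literature.Computability.Complexity

open Finset Blocks SipserHash PostBPPHash SipserGacs Literature.InformationTheory.Entropy

namespace PEAHash

/-! ### Products of fibre sizes versus powers of two -/

section LogProd

variable {ι : Type*} [Fintype ι]

/-- If `Σ log₂ fᵢ ≤ L` for positive naturals `fᵢ` then `Π fᵢ ≤ 2^L`. [folklore] -/
theorem prod_le_two_pow_of_sum_logb_le (f : ι → ℕ) (hf : ∀ i, 0 < f i) (L : ℕ)
    (h : ∑ i, Real.logb 2 (f i) ≤ L) : ∏ i, f i ≤ 2 ^ L := by
  have hpos : (0 : ℝ) < ∏ i, (f i : ℝ) := prod_pos fun i _ => by exact_mod_cast hf i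
  have hlog : Real.logb 2 (∏ i, (f i : ℝ)) ≤ L := by
    rw [Real.logb_prod _ _ fun i _ => by exact_mod_cast (hf i).ne']
    exact h
  rw [Real.logb_le_iff_le_rpow (by norm_num) hpos, Real.rpow_natCast] at hlog
  exact_mod_cast hlog

/-- If `L ≤ Σ log₂ fᵢ` for positive naturals `fᵢ` then `2^L ≤ Π fᵢ`. [folklore] -/
theorem two_pow_le_prod_of_le_sum_logb (f : ι → ℕ) (hf : ∀ i, 0 < f i) (L : ℕ)
    (h : (L : ℝ) ≤ ∑ i, Real.logb 2 (f i)) : 2 ^ L ≤ ∏ i, f i := by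
  have hpos : (0 : ℝ) < ∏ i, (f i : ℝ) := prod_pos fun i _ => by exact_mod_cast hf i
  have hlog : (L : ℝ) ≤ Real.logb 2 (∏ i, (f i : ℝ)) := by
    rw [Real.logb_prod _ _ fun i _ => by exact_mod_cast (hf i).ne']
    exact h
  rw [Real.le_logb_iff_rpow_le (by norm_num) hpos, Real.rpow_natCast] at hlog
  exact_mod_cast hlog

end LogProd

/-! ### Parameter arithmetic -/

section Params

variable {n' k : ℕ}

/-- `T = 4 · (32 n'²)`. [folklore] -/
theorem pT_eq (n' : ℕ) : pT n' = 4 * (32 * n' ^ 2) := by unfold pT; ring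

/-- The quarter `q = T/4 = 32 n'²` is at least `32` when `n' ≥ 1`. [folklore] -/
theorem quarter_ge (hn : 1 ≤ n') : 32 ≤ 32 * n' ^ 2 := by nlinarith

/-- `r = (T(n'-k-1) + q) + q` for `k < n'` (`q = T/4`): the hash length sits a quarter of `T` above
the YES threshold. [folklore] -/
theorem pR_eq (hk : k < n') : pR n' k = (pT n' * (n' - k - 1) + 32 * n' ^ 2) + 32 * n' ^ 2 := by
  unfold pR
  set m := 32 * n' ^ 2 with hm
  have h4 : pT n' = 4 * m := pT_eq n'
  obtain ⟨d, hd⟩ : ∃ d, n' - k = d + 1 := ⟨n' - k - 1, by omega⟩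
  rw [h4, hd, show d + 1 - 1 = d from rfl, show 4 * m / 2 = 2 * m by omega,
    show 4 * m * (d + 1) = 4 * m * d + 4 * m by ring]
  generalize 4 * m * d = X
  omega

/-- The NO threshold `r + q = T(n'-k) - q`. [folklore] -/
theorem pR_add_quarter (hk : k < n') : pR n' k + 32 * n' ^ 2 = pT n' * (n' - k) - 32 * n' ^ 2 := by
  rw [pR_eq hk]
  set m := 32 * n' ^ 2 with hm
  have h4 : pT n' = 4 * m := pT_eq n'
  obtain ⟨d, hd⟩ : ∃ d, n' - k = d + 1 := ⟨n' - k - 1, by omega⟩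
  rw [h4, hd, show d + 1 - 1 = d from rfl, show 4 * m * (d + 1) = 4 * m * d + 4 * m by ring]
  generalize 4 * m * d = X
  omega

end Params

/-! ### The size of `S` on YES and NO instances -/

section Size

variable (Q : List (List (List ℕ))) {n' k : ℕ}

/-- For a typical tuple of a YES instance the product fibre is small: `|fibre_T(Y)| ≤ 2^{r - q}`. [cite: Sipser1983, §V] -/
theorem card_fibT_le_of_typical (hk : k < n') (hH : (k : ℝ) + 1 ≤ mapEntropy univ (evalV Q n'))
    (Y : Fin (pT n') → (Fin n' → Bool))
    (hY : ¬ ((pT n' : ℝ) / 4 ≤ |∑ i, Real.logb 2 (fib Q n' (Y i)).card -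
        (pT n' : ℝ) * (n' - mapEntropy univ (evalV Q n'))|)) :
    (fibT Q n' (tupleEquiv (pT n') n' Y)).card ≤ 2 ^ (pT n' * (n' - k - 1) + 32 * n' ^ 2) := by
  rw [card_fibT_eq_prod]
  refine prod_le_two_pow_of_sum_logb_le _ (fun i => card_fib_pos Q n' (Y i)) _ ?_
  have h1 := (abs_lt.1 (not_le.1 hY)).2
  have hT : (pT n' : ℝ) = 4 * (32 * (n' : ℝ) ^ 2) := by rw [pT_eq]; push_cast; ring
  have hk' : ((n' - k - 1 : ℕ) : ℝ) = (n' : ℝ) - k - 1 := by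
    rw [Nat.sub_sub, Nat.cast_sub (by omega)]; push_cast; ring
  have hT0 : (0 : ℝ) ≤ pT n' := by positivity
  have : (pT n' : ℝ) * (n' - mapEntropy univ (evalV Q n')) ≤ (pT n' : ℝ) * ((n' : ℝ) - k - 1) :=
    mul_le_mul_of_nonneg_left (by linarith) hT0
  push_cast
  rw [hk']
  linarith

/-- For a typical tuple of a NO instance the product fibre is large: `2^{r + q} ≤ |fibre_T(Y)|`. [cite: Sipser1983, §V] -/
theorem le_card_fibT_of_typical (hk : k < n') (hH : mapEntropy univ (evalV Q n') ≤ k)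
    (Y : Fin (pT n') → (Fin n' → Bool))
    (hY : ¬ ((pT n' : ℝ) / 4 ≤ |∑ i, Real.logb 2 (fib Q n' (Y i)).card -
        (pT n' : ℝ) * (n' - mapEntropy univ (evalV Q n'))|)) :
    2 ^ (pR n' k + 32 * n' ^ 2) ≤ (fibT Q n' (tupleEquiv (pT n') n' Y)).card := by
  rw [card_fibT_eq_prod]
  refine two_pow_le_prod_of_le_sum_logb _ (fun i => card_fib_pos Q n' (Y i)) _ ?_
  have h1 := (abs_lt.1 (not_le.1 hY)).1
  rw [pR_add_quarter hk]
  have hT : (pT n' : ℝ) = 4 * (32 * (n' : ℝ) ^ 2) := by rw [pT_eq]; push_cast; ring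
  have hsub : ((pT n' * (n' - k) - 32 * n' ^ 2 : ℕ) : ℝ) = (pT n' : ℝ) * ((n' : ℝ) - k) - 32 * (n' : ℝ) ^ 2 := by
    have hle : 32 * n' ^ 2 ≤ pT n' * (n' - k) := by
      rw [pT_eq]; have : 1 ≤ n' - k := by omega
      nlinarith
    rw [Nat.cast_sub hle, Nat.cast_mul, Nat.cast_sub hk.le]; push_cast; ring
  have hT0 : (0 : ℝ) ≤ pT n' := by positivity
  have : (pT n' : ℝ) * ((n' : ℝ) - k) ≤ (pT n' : ℝ) * (n' - mapEntropy univ (evalV Q n')) :=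
    mul_le_mul_of_nonneg_left (by linarith) hT0
  rw [hsub]
  linarith

/-- **YES instances: `4 |S| ≤ 2^M`.** [cite: Sipser1983, §V] -/
theorem four_mul_card_npSet_le (hn : 1 ≤ n') (hk : k < n') (hH : (k : ℝ) + 1 ≤ mapEntropy univ (evalV Q n')) :
    4 * (npSet Q n' k).card ≤ 2 ^ pM n' k := by
  classical
  set T := pT n' with hT
  set q := 32 * n' ^ 2 with hq
  set r := pR n' k with hr
  set N := pN n' with hN
  set lam := pT n' * (n' - k - 1) + q with hlam
  set W := 2 ^ (N * r) * 2 ^ r with hW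
  have hrq : r = lam + q := by rw [hr, pR_eq hk]
  have hq3 : 3 ≤ q := le_trans (by norm_num) (quarter_ge hn)
  -- the atypical tuples
  set B := (univ : Finset (Fin T → (Fin n' → Bool))).filter fun Y =>
      (T : ℝ) / 4 ≤ |∑ i, Real.logb 2 (fib Q n' (Y i)).card - (T : ℝ) * (n' - mapEntropy univ (evalV Q n'))| with hB
  have hBcard : 8 * B.card ≤ 2 ^ (n' * T) := card_far_logfib_le Q n' hn
  have hNT : n' * T = N := by rw [hN, pN, hT, mul_comm]
  -- termwise bound
  have hterm : ∀ Y : Fin T → (Fin n' → Bool),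
      (hitSet r (fibT Q n' (tupleEquiv T n' Y))).card ≤ (if Y ∈ B then W else 2 ^ lam * 2 ^ (N * r)) := by
    intro Y
    by_cases hY : Y ∈ B
    · rw [if_pos hY, hW, ← card_univ_hash (N := N) (r := r)]
      exact card_le_univ _
    · rw [if_neg hY]
      refine (card_hitSet_le _).trans (Nat.mul_le_mul_right _ ?_)
      have hY' := hY
      rw [hB, mem_filter, not_and] at hY'
      exact card_fibT_le_of_typical Q hk hH Y (hY' (mem_univ _))
  have hsum : (npSet Q n' k).card ≤ B.card * W + 2 ^ N * (2 ^ lam * 2 ^ (N * r)) := by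
    rw [card_npSet_eq_sum]
    refine (sum_le_sum fun Y _ => hterm Y).trans ?_
    rw [sum_ite, sum_const, sum_const, smul_eq_mul, smul_eq_mul]
    refine Nat.add_le_add (Nat.mul_le_mul_right _ (card_le_card fun Y hY => (mem_filter.1 hY).2))
      (Nat.mul_le_mul_right _ ?_)
    refine (card_le_univ _).trans (le_of_eq ?_)
    rw [Fintype.card_fun, Fintype.card_fun, Fintype.card_bool, Fintype.card_fin, Fintype.card_fin, ← pow_mul, hNT]
  -- exponents: `M = N + (X + r)` with `X = rN`
  have hM : pM n' k = N + (r * N + r) := rfl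
  have hXc : N * r = r * N := mul_comm _ _
  have h3 : 2 ^ N * W = 2 ^ (pM n' k - 1) * 2 := by
    rw [hW, ← pow_succ, hM, ← pow_add, ← pow_add, hXc]
    congr 1
    generalize r * N = X
    omega
  have h1 : 4 * (B.card * W) ≤ 2 ^ (pM n' k - 1) := by
    have hx : 4 * (B.card * W) * 2 ≤ 2 ^ (pM n' k - 1) * 2 := by
      calc 4 * (B.card * W) * 2 = (8 * B.card) * W := by ring
        _ ≤ 2 ^ N * W := Nat.mul_le_mul_right _ (hNT ▸ hBcard)
        _ = 2 ^ (pM n' k - 1) * 2 := h3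
    exact Nat.le_of_mul_le_mul_right hx (by norm_num)
  have h2 : 4 * (2 ^ N * (2 ^ lam * 2 ^ (N * r))) ≤ 2 ^ (pM n' k - 1) := by
    rw [show (4 : ℕ) = 2 ^ 2 by norm_num, ← pow_add, ← pow_add, ← pow_add]
    apply Nat.pow_le_pow_right (by norm_num)
    rw [hM, hXc, hrq]
    generalize (lam + q) * N = X
    omega
  have h4 : 2 ^ (pM n' k - 1) + 2 ^ (pM n' k - 1) = 2 ^ pM n' k := by
    rw [← two_mul, ← pow_succ']
    congr 1
    rw [hM]
    generalize r * N = X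
    omega
  calc 4 * (npSet Q n' k).card
      ≤ 4 * (B.card * W) + 4 * (2 ^ N * (2 ^ lam * 2 ^ (N * r))) := by
        rw [← Nat.mul_add]; exact Nat.mul_le_mul_left 4 hsum
    _ ≤ 2 ^ (pM n' k - 1) + 2 ^ (pM n' k - 1) := Nat.add_le_add h1 h2
    _ = 2 ^ pM n' k := h4

/-- **NO instances with `k < n'`: `3 · 2^M ≤ 4 |S|`.** [cite: Sipser1983, §V] -/
theorem three_mul_two_pow_le_four_mul_card_npSet (hn : 1 ≤ n') (hk : k < n')
    (hH : mapEntropy univ (evalV Q n') ≤ k) :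
    3 * 2 ^ pM n' k ≤ 4 * (npSet Q n' k).card := by
  classical
  set T := pT n' with hT
  set q := 32 * n' ^ 2 with hq
  set r := pR n' k with hr
  set N := pN n' with hN
  have hq3 : 3 ≤ q := le_trans (by norm_num) (quarter_ge hn)
  set B := (univ : Finset (Fin T → (Fin n' → Bool))).filter fun Y =>
      (T : ℝ) / 4 ≤ |∑ i, Real.logb 2 (fib Q n' (Y i)).card - (T : ℝ) * (n' - mapEntropy univ (evalV Q n'))| with hB
  have hBcard : 8 * B.card ≤ 2 ^ (n' * T) := card_far_logfib_le Q n' hn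
  have hNT : n' * T = N := by rw [hN, pN, hT, mul_comm]
  have hN3 : 3 ≤ N := by
    rw [← hNT, hT, pT]
    nlinarith
  have hqr : q ≤ r := by rw [hr, pR_eq hk]; omega
  -- `a = 2^{N-3}`, `c = 2^{Nr + r - q}`, `P = 2^q`
  set a := 2 ^ (N - 3) with ha
  set c := 2 ^ (N * r + (r - q)) with hc
  set P := 2 ^ q with hP
  have hP7 : 7 ≤ P := le_trans (by norm_num) (Nat.pow_le_pow_right (by norm_num) hq3 : 2 ^ 3 ≤ 2 ^ q)
  have h2N : 2 ^ N = 8 * a := by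
    rw [ha, show (8 : ℕ) = 2 ^ 3 by norm_num, ← pow_add]; congr 1; omega
  have hcP : 2 ^ (N * r) * 2 ^ r = c * P := by
    rw [hc, hP, ← pow_add, ← pow_add]; congr 1; omega
  have hM : 2 ^ pM n' k = 8 * a * (c * P) := by
    rw [← h2N, ← hcP, ← pow_add, ← pow_add]
    congr 1
    show N + (r * N + r) = N + (N * r + r)
    rw [mul_comm]
  -- good tuples: at least `7a` of them
  have hgood : 7 * a ≤ (univ \ B).card := by
    rw [card_sdiff, inter_univ, card_univ, Fintype.card_fun, Fintype.card_fun, Fintype.card_bool,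
      Fintype.card_fin, Fintype.card_fin, ← pow_mul, hNT, h2N]
    have : B.card ≤ a := by
      have : 8 * B.card ≤ 8 * a := by rw [← h2N, ← hNT]; exact hBcard
      omega
    omega
  -- each good tuple is hit by at least `c (P - 1)` hashes
  have hterm : ∀ Y ∈ univ \ B, c * (P - 1) ≤ (hitSet r (fibT Q n' (tupleEquiv T n' Y))).card := by
    intro Y hY
    have hY' : ¬ ((T : ℝ) / 4 ≤ |∑ i, Real.logb 2 (fib Q n' (Y i)).card -
        (T : ℝ) * (n' - mapEntropy univ (evalV Q n'))|) := by
      have := (mem_sdiff.1 hY).2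
      rw [hB, mem_filter, not_and] at this
      exact this (mem_univ _)
    have hbig : 2 ^ (r + q) ≤ (fibT Q n' (tupleEquiv T n' Y)).card := le_card_fibT_of_typical Q hk hH Y hY'
    set F := fibT Q n' (tupleEquiv T n' Y) with hF
    have hmiss := card_missSet_mul_le (r := r) F
    have hsplit := card_hitSet_add_card_missSet (r := r) F
    rw [hcP] at hsplit hmiss
    -- `miss · 2^r · P ≤ miss · |F| ≤ c P 2^r`, hence `miss ≤ c`
    have hmc : (missSet r F).card ≤ c := by
      have h1 : (missSet r F).card * (2 ^ r * P) ≤ c * P * 2 ^ r := by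
        calc (missSet r F).card * (2 ^ r * P) = (missSet r F).card * 2 ^ (r + q) := by rw [hP, pow_add]
          _ ≤ (missSet r F).card * F.card := Nat.mul_le_mul_left _ hbig
          _ ≤ c * P * 2 ^ r := hmiss
      have h2 : (missSet r F).card * P * (2 ^ r) ≤ c * P * 2 ^ r := by
        calc (missSet r F).card * P * 2 ^ r = (missSet r F).card * (2 ^ r * P) := by ring
          _ ≤ c * P * 2 ^ r := h1
      have h3 : (missSet r F).card * P ≤ c * P := Nat.le_of_mul_le_mul_right h2 (by positivity)
      exact Nat.le_of_mul_le_mul_right h3 (by positivity)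
    have hsub : c * (P - 1) = c * P - c := Nat.mul_sub_one c P
    rw [hsub]
    omega
  -- sum over the good tuples
  have hS : 7 * a * (c * (P - 1)) ≤ (npSet Q n' k).card := by
    rw [card_npSet_eq_sum]
    calc 7 * a * (c * (P - 1)) ≤ (univ \ B).card * (c * (P - 1)) := Nat.mul_le_mul_right _ hgood
      _ = ∑ _Y ∈ univ \ B, c * (P - 1) := by rw [sum_const, smul_eq_mul]
      _ ≤ ∑ Y ∈ univ \ B, (hitSet r (fibT Q n' (tupleEquiv T n' Y))).card := sum_le_sum hterm
      _ ≤ ∑ Y, (hitSet r (fibT Q n' (tupleEquiv T n' Y))).card :=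
          sum_le_sum_of_subset_of_nonneg (subset_univ _) fun _ _ _ => Nat.zero_le _
  -- arithmetic: `3 · 8a · cP ≤ 4 · 7a · c (P - 1)` since `P ≥ 7`
  rw [hM]
  have hlin : 24 * P ≤ 28 * (P - 1) := by omega
  calc 3 * (8 * a * (c * P)) = a * c * (24 * P) := by ring
    _ ≤ a * c * (28 * (P - 1)) := Nat.mul_le_mul_left _ hlin
    _ = 4 * (7 * a * (c * (P - 1))) := by ring
    _ ≤ 4 * (npSet Q n' k).card := Nat.mul_le_mul_left 4 hS

end Size

/-! ### The criterion -/

section Criterion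

variable (Q : List (List (List ℕ))) {n' k : ℕ}

/-- `1 ≤ M`, `M ≤ t`, `13 ≤ t` for the Sipser lemmas (`n' ≥ 1`). [folklore] -/
theorem pM_pos (hn : 1 ≤ n') : 1 ≤ pM n' k := by
  unfold pM pN pT
  have h1 : 1 * 1 ≤ n' ^ 2 * n' := Nat.mul_le_mul (Nat.one_le_pow _ _ hn) hn
  have h2 : 128 * n' ^ 2 * n' = 128 * (n' ^ 2 * n') := by ring
  omega

/-- **YES ⟹ hashable**: if `k + 1 ≤ H(Q(U))` (`n' ≥ 1`, `k < n'`) then the `t`-fold power of `S`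
is separated by some family of `κ` matrices of format `κ × L`. [cite: Sipser1983, §V] -/
theorem hashable_of_yes (hn : 1 ≤ n') (hk : k < n') (hH : (k : ℝ) + 1 ≤ mapEntropy univ (evalV Q n')) :
    Hashable (tuplePow (npSet Q n' k) (pt n' k)) (pK n' k) := by
  have h := hashable_tuplePow_of_small (m := pM n' k) (t := pt n' k) (pM_pos hn) (by unfold pt; omega)
    (four_mul_card_npSet_le Q hn hk hH)
  exact h

/-- **NO ⟹ not hashable**: if `H(Q(U)) ≤ k < n'` (`n' ≥ 1`) then no family of `κ` matrices
separates the `t`-fold power of `S`. [cite: Sipser1983, §V] -/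
theorem not_hashable_of_no (hn : 1 ≤ n') (hk : k < n') (hH : mapEntropy univ (evalV Q n') ≤ k) :
    ¬ Hashable (tuplePow (npSet Q n' k) (pt n' k)) (pK n' k) := by
  have hM := pM_pos (k := k) hn
  have h13 : 13 ≤ pt n' k := by
    unfold pt pM pN pT
    have h1 : 1 * 1 ≤ n' ^ 2 * n' := Nat.mul_le_mul (Nat.one_le_pow _ _ hn) hn
    have h2 : 128 * n' ^ 2 * n' = 128 * (n' ^ 2 * n') := by ring
    omega
  exact not_hashable_tuplePow_of_large (m := pM n' k) (t := pt n' k) hM (by unfold pt; omega) h13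
    (three_mul_two_pow_le_four_mul_card_npSet Q hn hk hH)

end Criterion

/-! ### The criterion on instances of `PEA` -/

section Instances

variable (I : PEAInst)

/-- **A YES instance passes the criterion**: if `k + 1 ≤ H(p(U_n))` then `k < n'` and the `t`-fold
power of `S` (for the renamed map) is hashable at level `κ`. [cite: Sipser1983, §V]
[cite: DvirGutfreundRothblumVadhan2010, §3 p.6] -/
theorem hashable_of_entropy_ge (hH : (I.2.2 : ℝ) + 1 ≤ PolyMapF2.entropy I.2.1) :
    I.2.2 < nVars (erase I).2.1 ∧
      Hashable (tuplePow (npSet (rename (erase I).2.1) (nVars (erase I).2.1) I.2.2)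
        (pt (nVars (erase I).2.1) I.2.2)) (pK (nVars (erase I).2.1) I.2.2) := by
  have hle := entropy_le_nVars I
  have hk : I.2.2 < nVars (erase I).2.1 := by
    have : (I.2.2 : ℝ) < nVars (erase I).2.1 := by linarith
    exact_mod_cast this
  rw [entropy_eq_mapEntropy_rename] at hH
  exact ⟨hk, hashable_of_yes _ (by omega) hk hH⟩

/-- **A NO instance with `k < n'` fails the criterion**: if `H(p(U_n)) ≤ k < n'` then the `t`-fold
power of `S` is not hashable at level `κ`. [cite: Sipser1983, §V] [cite: DvirGutfreundRothblumVadhan2010, §3 p.6] -/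
theorem not_hashable_of_entropy_le (hH : PolyMapF2.entropy I.2.1 ≤ I.2.2) (hk : I.2.2 < nVars (erase I).2.1) :
    ¬ Hashable (tuplePow (npSet (rename (erase I).2.1) (nVars (erase I).2.1) I.2.2)
        (pt (nVars (erase I).2.1) I.2.2)) (pK (nVars (erase I).2.1) I.2.2) := by
  rw [entropy_eq_mapEntropy_rename] at hH
  exact not_hashable_of_no _ (by omega) hk hH

end Instances



end PEAHash

end Literature.Computability.Complexity
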